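import Literature.NumberTheory.Automorphic.PrincipalSeriesGL2JacquetOpenCell
import Literature.NumberTheory.Automorphic.Zelevinsky1980.UnitaryCharacterInductionIrreducible
import Literature.NumberTheory.Automorphic.Zelevinsky1980.DetCharInducingDatum
import Literature.NumberTheory.Automorphic.Liu2021.LemD1LocalInjectivity
import Mathlib.RepresentationTheory.Irreducible
import Mathlib.LinearAlgebra.Dual.Lemmas
import HarnessLib

/-!
# The Weyl symmetry of the unitary principal series of `GL₂(F)`: `i(ν ⊠ χ′) ≅ i(χ′ ⊠ ν)`

Topic `NumberTheory/Automorphic` (namespace `Literature.NumberTheory.Automorphic.Zelevinsky1980`); THEOREMS ONLY (no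
definition, no named fact, no `sorry`, no instance, no notation).  `F` is a non-archimedean local field with
`q_F = #𝓀_F`, `P = Q_{1,1} = standardParabolicGL F (lastBlockLabel 2)` the upper Borel subgroup of `GL₂(F)`, `U` its
unipotent radical, and for characters `ν, χ′ : Fˣ → ℂˣ` the tree's normalised principal series is
`i(ν ⊠ χ′) = Representation.parabolicIndGL F (lastBlockLabel 2) (𝟙.twist (maxParabolicLeviChar F 2 ν χ′)) = Ind_P^{GL₂} σ'`,
`σ' = ((ν ∘ det_{GL₁}) ⊠ χ′) ∘ proj ⊗ δ_P^{1/2}` (`DetCharInducingDatum`, `parabolicIndGL = smoothIndRep P σ'` by `rfl`).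

MAIN THEOREM `areIsomorphicRep_parabolicIndGL_two_swap`: **for UNITARY CONTINUOUS `ν, χ′` the representations
`i(ν ⊠ χ′)` and `i(χ′ ⊠ ν)` of `GL₂(F)` are isomorphic** (`Liu2021.AreIsomorphicRep`, an equivariant linear
equivalence) — [BernsteinZelevinsky1977, Thm. 2.9] ∕ [Bump1997, Thm. 4.5.3]: irreducible principal series with the
same inducing characters up to the Weyl group element `w₀` are isomorphic.

## Proof ([BernsteinZelevinsky1977, Geometrical Lemma 2.12 ∕ Thm. 5.2 and §7.1] for the pair `(Q_{1,1}, Q_{1,1})`;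
[Casselman1995, §6.3, Lemma 7.1.1]; [Bump1997, §4.5])

For `ν = χ′` there is nothing to prove.  For `ν ≠ χ′` (§3, `exists_swapFunctional`): let `I = Ind_P^{GL₂} σ'`,
`J = I_U` its `U`-coinvariants (★ `Representation.restrictUnipotentGL`, with the `P`-action ★
`Representation.toCoinvariants`), `I_open ≤ I` the functions vanishing on `P` (★ `vanishingOn … (cellLT … w₀)`; for
`GL₂` the closed cell is `P`) and `K₀ = [I_open] ≤ J` the OPEN-CELL part.  Then
(1) `K₀ ≠ 0`: the standard section `Φ_{K'}` has non-zero class (★ `SmoothInd.mk_coinvariants_ne_zero_of_cellFun_eq_indicator`,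
the open-cell Haar functional); (2) `P` acts on `K₀` by the SWAPPED character `σ'' = ((χ′ ∘ det) ⊠ ν) ∘ proj ⊗ δ^{1/2}`:
on `d(ϖ) = diag(1, ϖ)` by `q_F · σ'(d₀(ϖ)) = ν(ϖ) √q_F = σ''(d(ϖ))` (★ `mk_smoothIndRep_diag_eq_smul_of_mem_vanishingOn`,
the open-cell exponent), on scalars by `σ' = σ''`, trivially on `U`, hence on all of `P = ⟨U, scalars, d(Fˣ)⟩` because
`Fˣ` is generated by its uniformizers (★ `monoidHom_ext_of_isUniformizingElement`); (3) for a uniformizer `ϖ` with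
`ν(ϖ) ≠ χ′(ϖ)` (★ `exists_isUniformizingElement_map_ne`) the operator `A = J(d(ϖ))` has the closed-cell eigenvalue
`a = σ'(d(ϖ)) = χ′(ϖ) √q_F` on `J ⁄ K₀ ≅ ℂ` (evaluation at `1`) and the open-cell eigenvalue `b = ν(ϖ) √q_F ≠ a` on `K₀`,
so `(A − a) J ≤ K₀`, and `A` commutes with `J(P)` (`P ⁄ U` is commutative); (4) for a linear functional `Λ` non-zero
on `K₀`, `λ(f) = Λ((A − a)[f])` is a NON-ZERO `(P, σ'')`-eigenfunctional on `I`.  Frobenius reciprocity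
(★ `Representation.frobeniusInv`) turns `λ` into a non-zero intertwining operator `M(w₀) : i(ν ⊠ χ′) → i(χ′ ⊠ ν)`; both
sides are irreducible for unitary `ν, χ′` (★ `parabolicIndGL_detChar_unitary_isIrreducible_holds`, [Zelevinsky1980,
Thm. 4.2]), so `M(w₀)` is an isomorphism (Schur, Mathlib `Representation.IsIrreducible.bijective_or_eq_zero`).

Consumer (cell hodgecm-mathlib, crux `HLiu418`, P5 pay-down of letter #74): the split-place half of
[Liu2021, Lem. D.1 (4)] at `n = 2` — at a place split in the CM extension both local theta factors are principal
series of `GL₂` (★ `Liu2021.splitPlace_chiCoinv_iso_parabolicIndGL`) with SWAPPED inducing data.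

## References
* [BernsteinZelevinsky1977] I. N. Bernstein, A. V. Zelevinsky, *Induced representations of reductive `p`-adic
  groups. I*, Ann. Sci. ÉNS 10 (1977): Prop. 1.9, Geometrical Lemma 2.12, Thm. 2.9, Thm. 5.2, §7.1.
* [Zelevinsky1980] A. V. Zelevinsky, *Induced representations of reductive `p`-adic groups. II*, Ann. Sci. ÉNS 13
  (1980), §1.1, §3.2, Thm. 4.2.
* [Bump1997] D. Bump, *Automorphic forms and representations*, CUP (1997), §4.5, Thm. 4.5.3.
* [Casselman1995] W. Casselman, *Introduction to the theory of admissible representations of `p`-adic reductive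
  groups* (draft 1995), Thm. 3.2.4, §6.3, Lemma 7.1.1.
-/

set_option autoImplicit false

noncomputable section

open Matrix Literature.LinearAlgebra.Matrix.DiagonalTorus
open scoped NNReal

namespace Literature.NumberTheory.Automorphic.Zelevinsky1980

open Literature.NumberTheory.Automorphic ValuativeRel

universe u

variable {F : Type u} [Field F] [ValuativeRel F] [TopologicalSpace F] [IsNonarchimedeanLocalField F]

/-! ## §3 The swapped eigenfunctional — abstract form

To keep the terms small the bookkeeping of [BernsteinZelevinsky1977, §7.1] is done for an ARBITRARY representation `JP` of
`Q_{1,1}` on a module `J` (the Jacquet module), a `Q_{1,1}`-stable submodule `K₀ ≤ J` (the open-cell part), a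
`Q_{1,1}`-module `V` with an equivariant map `mk : V → J` (the induced representation and the quotient map) and two characters
`σ', σ''`; §4 instantiates it at `Ind_{Q_{1,1}}^{GL₂} σ'`. -/

section Abstract

variable (σ' σ'' : Representation ℂ ↥(standardParabolicGL F (lastBlockLabel 2)) ℂ)
  {J : Type*} [AddCommGroup J] [Module ℂ J] (JP : Representation ℂ ↥(standardParabolicGL F (lastBlockLabel 2)) J) (K₀ : Submodule ℂ J)

/-- **The torus `d(Fˣ)` acts on `K₀` by `σ''`** as soon as every `d(ϖ)`, `ϖ` a uniformizer, does (and `K₀` is stable):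
`Fˣ` is generated by its uniformizers (`units_mem_of_forall_isUniformizingElement_mem`). [cite: BernsteinZelevinsky1977, §7.1] [cite: Serre1979, Chap. I §1] -/
theorem jacquetData_smul_of_mem_of_uniformizer (hK : ∀ (p : ↥(standardParabolicGL F (lastBlockLabel 2))) (y : J), y ∈ K₀ → JP p y ∈ K₀)
    (hunif : ∀ (ϖ : F) (hϖ : IsUniformizingElement ϖ) (y : J), y ∈ K₀ →
      JP (⟨diagGL (Fin 2) (Function.update 1 (Fin.last 1) (Units.mk0 ϖ hϖ.ne_zero)), diagGL_mem_standardParabolicGL _ _⟩ : ↥(standardParabolicGL F (lastBlockLabel 2))) y = σ'' (⟨diagGL (Fin 2) (Function.update 1 (Fin.last 1) (Units.mk0 ϖ hϖ.ne_zero)), diagGL_mem_standardParabolicGL _ _⟩ : ↥(standardParabolicGL F (lastBlockLabel 2))) 1 • y)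
    (x : Fˣ) (y : J) (hy : y ∈ K₀) :
    JP (⟨diagGL (Fin 2) (Function.update 1 (Fin.last 1) x), diagGL_mem_standardParabolicGL _ _⟩ : ↥(standardParabolicGL F (lastBlockLabel 2))) y = σ'' (⟨diagGL (Fin 2) (Function.update 1 (Fin.last 1) x), diagGL_mem_standardParabolicGL _ _⟩ : ↥(standardParabolicGL F (lastBlockLabel 2))) 1 • y := by
  revert y
  refine units_mem_of_forall_isUniformizingElement_mem
    (S := {x' : Fˣ | ∀ y : J, y ∈ K₀ → JP (⟨diagGL (Fin 2) (Function.update 1 (Fin.last 1) x'), diagGL_mem_standardParabolicGL _ _⟩ : ↥(standardParabolicGL F (lastBlockLabel 2))) y = σ'' (⟨diagGL (Fin 2) (Function.update 1 (Fin.last 1) x'), diagGL_mem_standardParabolicGL _ _⟩ : ↥(standardParabolicGL F (lastBlockLabel 2))) 1 • y}) ?_ ?_ ?_ hunif x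
  · -- `1`
    intro y hy
    rw [diagLast_one, map_one JP, map_one σ'', Module.End.one_apply, Module.End.one_apply, one_smul]
  · -- products
    intro a b ha hb y hy
    rw [diagLast_mul, map_mul JP, Module.End.mul_apply, hb y hy, LinearMap.map_smul, ha y hy, smul_smul,
      map_mul σ'', Module.End.mul_apply, apply_eq_mul_apply_one_two σ'' (⟨diagGL (Fin 2) (Function.update 1 (Fin.last 1) a), diagGL_mem_standardParabolicGL _ _⟩ : ↥(standardParabolicGL F (lastBlockLabel 2))) (σ'' (⟨diagGL (Fin 2) (Function.update 1 (Fin.last 1) b), diagGL_mem_standardParabolicGL _ _⟩ : ↥(standardParabolicGL F (lastBlockLabel 2))) 1), mul_comm]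
  · -- inverses
    intro a ha y hy
    have h1 := ha _ (hK (⟨diagGL (Fin 2) (Function.update 1 (Fin.last 1) a⁻¹), diagGL_mem_standardParabolicGL _ _⟩ : ↥(standardParabolicGL F (lastBlockLabel 2))) y hy)
    rw [← Module.End.mul_apply, ← map_mul JP, ← diagLast_mul, mul_inv_cancel, diagLast_one, map_one JP,
      Module.End.one_apply] at h1
    have hc : σ'' (⟨diagGL (Fin 2) (Function.update 1 (Fin.last 1) a⁻¹), diagGL_mem_standardParabolicGL _ _⟩ : ↥(standardParabolicGL F (lastBlockLabel 2))) 1 * σ'' (⟨diagGL (Fin 2) (Function.update 1 (Fin.last 1) a), diagGL_mem_standardParabolicGL _ _⟩ : ↥(standardParabolicGL F (lastBlockLabel 2))) 1 = 1 := by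
      rw [← apply_eq_mul_apply_one_two, ← Module.End.mul_apply, ← map_mul σ'', ← diagLast_mul, inv_mul_cancel,
        diagLast_one, map_one σ'', Module.End.one_apply]
    calc JP (⟨diagGL (Fin 2) (Function.update 1 (Fin.last 1) a⁻¹), diagGL_mem_standardParabolicGL _ _⟩ : ↥(standardParabolicGL F (lastBlockLabel 2))) y
        = (σ'' (⟨diagGL (Fin 2) (Function.update 1 (Fin.last 1) a⁻¹), diagGL_mem_standardParabolicGL _ _⟩ : ↥(standardParabolicGL F (lastBlockLabel 2))) 1 * σ'' (⟨diagGL (Fin 2) (Function.update 1 (Fin.last 1) a), diagGL_mem_standardParabolicGL _ _⟩ : ↥(standardParabolicGL F (lastBlockLabel 2))) 1) • JP (⟨diagGL (Fin 2) (Function.update 1 (Fin.last 1) a⁻¹), diagGL_mem_standardParabolicGL _ _⟩ : ↥(standardParabolicGL F (lastBlockLabel 2))) y := by rw [hc, one_smul]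
      _ = σ'' (⟨diagGL (Fin 2) (Function.update 1 (Fin.last 1) a⁻¹), diagGL_mem_standardParabolicGL _ _⟩ : ↥(standardParabolicGL F (lastBlockLabel 2))) 1 • y := by rw [mul_smul, ← h1]

/-- **`Q_{1,1}` acts on `K₀` by `σ''`** when `U` acts trivially, the scalars `z(t)` act by `σ''(z(t))` and the `d(ϖ)` act by
`σ''(d(ϖ))` (`p = z(t) · d(x) · u`). [cite: BernsteinZelevinsky1977, Thm. 5.2 and §7.1] -/
theorem jacquetData_smul_of_mem (hK : ∀ (p : ↥(standardParabolicGL F (lastBlockLabel 2))) (y : J), y ∈ K₀ → JP p y ∈ K₀)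
    (hU : ∀ u : ↥(standardParabolicGL F (lastBlockLabel 2)), u ∈ (unipotentRadicalP F (lastBlockLabel 2)) → ∀ y : J, JP u y = y)
    (hU'' : ∀ u : ↥(standardParabolicGL F (lastBlockLabel 2)), u ∈ (unipotentRadicalP F (lastBlockLabel 2)) → σ'' u = 1)
    (hz : ∀ (t : Fˣ) (y : J), JP (⟨diagGL (Fin 2) (fun _ => t), diagGL_mem_standardParabolicGL _ _⟩ : ↥(standardParabolicGL F (lastBlockLabel 2))) y = σ'' (⟨diagGL (Fin 2) (fun _ => t), diagGL_mem_standardParabolicGL _ _⟩ : ↥(standardParabolicGL F (lastBlockLabel 2))) 1 • y)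
    (hunif : ∀ (ϖ : F) (hϖ : IsUniformizingElement ϖ) (y : J), y ∈ K₀ →
      JP (⟨diagGL (Fin 2) (Function.update 1 (Fin.last 1) (Units.mk0 ϖ hϖ.ne_zero)), diagGL_mem_standardParabolicGL _ _⟩ : ↥(standardParabolicGL F (lastBlockLabel 2))) y = σ'' (⟨diagGL (Fin 2) (Function.update 1 (Fin.last 1) (Units.mk0 ϖ hϖ.ne_zero)), diagGL_mem_standardParabolicGL _ _⟩ : ↥(standardParabolicGL F (lastBlockLabel 2))) 1 • y)
    (p : ↥(standardParabolicGL F (lastBlockLabel 2))) (y : J) (hy : y ∈ K₀) : JP p y = σ'' p 1 • y := by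
  obtain ⟨t, x, u, hu, hp⟩ := exists_scalar_mul_diag_mul_unipotent p
  have hp' : p = (⟨diagGL (Fin 2) (fun _ => t), diagGL_mem_standardParabolicGL _ _⟩ : ↥(standardParabolicGL F (lastBlockLabel 2))) * (⟨diagGL (Fin 2) (Function.update 1 (Fin.last 1) x), diagGL_mem_standardParabolicGL _ _⟩ : ↥(standardParabolicGL F (lastBlockLabel 2))) * u := Subtype.ext hp
  rw [hp', map_mul JP, map_mul JP, Module.End.mul_apply, Module.End.mul_apply, hU u hu,
    jacquetData_smul_of_mem_of_uniformizer σ'' JP K₀ hK hunif x y hy, LinearMap.map_smul, hz t, smul_smul, map_mul σ'', map_mul σ'',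
    Module.End.mul_apply, Module.End.mul_apply, hU'' u hu, Module.End.one_apply,
    apply_eq_mul_apply_one_two σ'' (⟨diagGL (Fin 2) (fun _ => t), diagGL_mem_standardParabolicGL _ _⟩ : ↥(standardParabolicGL F (lastBlockLabel 2))) (σ'' (⟨diagGL (Fin 2) (Function.update 1 (Fin.last 1) x), diagGL_mem_standardParabolicGL _ _⟩ : ↥(standardParabolicGL F (lastBlockLabel 2))) 1), mul_comm]

omit [ValuativeRel F] [TopologicalSpace F] [IsNonarchimedeanLocalField F] in
/-- **`Q_{1,1} ⁄ U` is commutative**: on a representation on which `U` acts trivially, every `p ∈ Q_{1,1}` commutes with every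
`d(x)`. [cite: BernsteinZelevinsky1977, §2.1] -/
theorem jacquetData_comm_diag (hU : ∀ u : ↥(standardParabolicGL F (lastBlockLabel 2)), u ∈ (unipotentRadicalP F (lastBlockLabel 2)) → ∀ y : J, JP u y = y) (p : ↥(standardParabolicGL F (lastBlockLabel 2))) (x : Fˣ) (y : J) :
    JP p (JP (⟨diagGL (Fin 2) (Function.update 1 (Fin.last 1) x), diagGL_mem_standardParabolicGL _ _⟩ : ↥(standardParabolicGL F (lastBlockLabel 2))) y) = JP (⟨diagGL (Fin 2) (Function.update 1 (Fin.last 1) x), diagGL_mem_standardParabolicGL _ _⟩ : ↥(standardParabolicGL F (lastBlockLabel 2))) (JP p y) := by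
  obtain ⟨t, x', u, hu, hp⟩ := exists_scalar_mul_diag_mul_unipotent p
  have hp' : p = (⟨diagGL (Fin 2) (fun _ => t), diagGL_mem_standardParabolicGL _ _⟩ : ↥(standardParabolicGL F (lastBlockLabel 2))) * (⟨diagGL (Fin 2) (Function.update 1 (Fin.last 1) x'), diagGL_mem_standardParabolicGL _ _⟩ : ↥(standardParabolicGL F (lastBlockLabel 2))) * u := Subtype.ext hp
  have key : (⟨diagGL (Fin 2) (fun _ => t), diagGL_mem_standardParabolicGL _ _⟩ : ↥(standardParabolicGL F (lastBlockLabel 2))) * (⟨diagGL (Fin 2) (Function.update 1 (Fin.last 1) x'), diagGL_mem_standardParabolicGL _ _⟩ : ↥(standardParabolicGL F (lastBlockLabel 2))) * (⟨diagGL (Fin 2) (Function.update 1 (Fin.last 1) x), diagGL_mem_standardParabolicGL _ _⟩ : ↥(standardParabolicGL F (lastBlockLabel 2))) = (⟨diagGL (Fin 2) (Function.update 1 (Fin.last 1) x), diagGL_mem_standardParabolicGL _ _⟩ : ↥(standardParabolicGL F (lastBlockLabel 2))) * ((⟨diagGL (Fin 2) (fun _ => t), diagGL_mem_standardParabolicGL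 _ _⟩ : ↥(standardParabolicGL F (lastBlockLabel 2))) * (⟨diagGL (Fin 2) (Function.update 1 (Fin.last 1) x'), diagGL_mem_standardParabolicGL _ _⟩ : ↥(standardParabolicGL F (lastBlockLabel 2)))) :=
    Subtype.ext (by
      simp only [Subgroup.coe_mul]
      rw [mul_assoc, diagGL_comm (Function.update 1 (Fin.last 1) x'), ← mul_assoc, diagGL_comm (fun _ => t), mul_assoc])
  calc JP p (JP (⟨diagGL (Fin 2) (Function.update 1 (Fin.last 1) x), diagGL_mem_standardParabolicGL _ _⟩ : ↥(standardParabolicGL F (lastBlockLabel 2))) y)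
      = JP ((⟨diagGL (Fin 2) (fun _ => t), diagGL_mem_standardParabolicGL _ _⟩ : ↥(standardParabolicGL F (lastBlockLabel 2))) * (⟨diagGL (Fin 2) (Function.update 1 (Fin.last 1) x'), diagGL_mem_standardParabolicGL _ _⟩ : ↥(standardParabolicGL F (lastBlockLabel 2)))) (JP (⟨diagGL (Fin 2) (Function.update 1 (Fin.last 1) x), diagGL_mem_standardParabolicGL _ _⟩ : ↥(standardParabolicGL F (lastBlockLabel 2))) y) := by rw [hp', map_mul JP _ u, Module.End.mul_apply, hU u hu]
    _ = JP ((⟨diagGL (Fin 2) (fun _ => t), diagGL_mem_standardParabolicGL _ _⟩ : ↥(standardParabolicGL F (lastBlockLabel 2))) * (⟨diagGL (Fin 2) (Function.update 1 (Fin.last 1) x'), diagGL_mem_standardParabolicGL _ _⟩ : ↥(standardParabolicGL F (lastBlockLabel 2))) * (⟨diagGL (Fin 2) (Function.update 1 (Fin.last 1) x), diagGL_mem_standardParabolicGL _ _⟩ : ↥(standardParabolicGL F (lastBlockLabel 2)))) y := by rw [map_mul JP _ (⟨diagGL (Fin 2) (Function.update 1 (Fin.last 1) x), diagGL_mem_standardParabolicGL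 _ _⟩ : ↥(standardParabolicGL F (lastBlockLabel 2))), Module.End.mul_apply]
    _ = JP ((⟨diagGL (Fin 2) (Function.update 1 (Fin.last 1) x), diagGL_mem_standardParabolicGL _ _⟩ : ↥(standardParabolicGL F (lastBlockLabel 2))) * ((⟨diagGL (Fin 2) (fun _ => t), diagGL_mem_standardParabolicGL _ _⟩ : ↥(standardParabolicGL F (lastBlockLabel 2))) * (⟨diagGL (Fin 2) (Function.update 1 (Fin.last 1) x'), diagGL_mem_standardParabolicGL _ _⟩ : ↥(standardParabolicGL F (lastBlockLabel 2))))) y := by rw [key]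
    _ = JP (⟨diagGL (Fin 2) (Function.update 1 (Fin.last 1) x), diagGL_mem_standardParabolicGL _ _⟩ : ↥(standardParabolicGL F (lastBlockLabel 2))) (JP ((⟨diagGL (Fin 2) (fun _ => t), diagGL_mem_standardParabolicGL _ _⟩ : ↥(standardParabolicGL F (lastBlockLabel 2))) * (⟨diagGL (Fin 2) (Function.update 1 (Fin.last 1) x'), diagGL_mem_standardParabolicGL _ _⟩ : ↥(standardParabolicGL F (lastBlockLabel 2)))) y) := by rw [map_mul JP (⟨diagGL (Fin 2) (Function.update 1 (Fin.last 1) x), diagGL_mem_standardParabolicGL _ _⟩ : ↥(standardParabolicGL F (lastBlockLabel 2))), Module.End.mul_apply]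
    _ = JP (⟨diagGL (Fin 2) (Function.update 1 (Fin.last 1) x), diagGL_mem_standardParabolicGL _ _⟩ : ↥(standardParabolicGL F (lastBlockLabel 2))) (JP p y) := by rw [hp', map_mul JP _ u, Module.End.mul_apply (JP _) (JP u), hU u hu]

variable {V : Type*} [AddCommGroup V] [Module ℂ V] (IP : Representation ℂ ↥(standardParabolicGL F (lastBlockLabel 2)) V) (mk : V →ₗ[ℂ] J)

omit [ValuativeRel F] [TopologicalSpace F] [IsNonarchimedeanLocalField F] in
/-- **THE SWAPPED EIGENFUNCTIONAL, abstract form.**  Data: a representation `IP` of `Q_{1,1}` on `V` (the induced representation),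
its «Jacquet module» `JP` on `J` with an equivariant `mk : V → J`, the «open-cell part» `K₀ ≤ J`, characters `σ'` (closed cell:
`mk (p v) − σ'(p) mk v ∈ K₀`) and `σ''` (acting on `K₀`), an element `d(ϖ)` acting on `K₀` by `b ≠ σ'(d(ϖ))`, and a vector of
`K₀` which is non-zero.  Then `λ(v) = Λ((d(ϖ) − σ'(d(ϖ))) mk v)`, for a linear functional `Λ` of `J` non-zero on that vector, is
a NON-ZERO `(Q_{1,1}, σ'')`-eigenfunctional on `V`. [cite: BernsteinZelevinsky1977, Thm. 5.2 and §7.1] [cite: Casselman1995, §6.3 and Lemma 7.1.1] -/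
theorem exists_eigenfunctional_of_jacquetData
    (hmk : ∀ (p : ↥(standardParabolicGL F (lastBlockLabel 2))) (v : V), mk (IP p v) = JP p (mk v))
    (hclosed : ∀ (p : ↥(standardParabolicGL F (lastBlockLabel 2))) (v : V), mk (IP p v) - σ' p 1 • mk v ∈ K₀)
    (hU : ∀ u : ↥(standardParabolicGL F (lastBlockLabel 2)), u ∈ (unipotentRadicalP F (lastBlockLabel 2)) → ∀ y : J, JP u y = y)
    (hsmul : ∀ (p : ↥(standardParabolicGL F (lastBlockLabel 2))) (y : J), y ∈ K₀ → JP p y = σ'' p 1 • y)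
    {x : Fˣ} {b : ℂ} (hb : ∀ y : J, y ∈ K₀ → JP (⟨diagGL (Fin 2) (Function.update 1 (Fin.last 1) x), diagGL_mem_standardParabolicGL _ _⟩ : ↥(standardParabolicGL F (lastBlockLabel 2))) y = b • y) (hab : b ≠ σ' (⟨diagGL (Fin 2) (Function.update 1 (Fin.last 1) x), diagGL_mem_standardParabolicGL _ _⟩ : ↥(standardParabolicGL F (lastBlockLabel 2))) 1)
    {v₀ : V} (hv₀ : mk v₀ ∈ K₀) (hv₀0 : mk v₀ ≠ 0) :
    ∃ lam : V →ₗ[ℂ] ℂ, lam v₀ ≠ 0 ∧ ∀ (p : ↥(standardParabolicGL F (lastBlockLabel 2))) (v : V), lam (IP p v) = σ'' p 1 * lam v := by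
  classical
  -- `(A − a) mk v ∈ K₀`
  have hAK : ∀ v : V, JP (⟨diagGL (Fin 2) (Function.update 1 (Fin.last 1) x), diagGL_mem_standardParabolicGL _ _⟩ : ↥(standardParabolicGL F (lastBlockLabel 2))) (mk v) - σ' (⟨diagGL (Fin 2) (Function.update 1 (Fin.last 1) x), diagGL_mem_standardParabolicGL _ _⟩ : ↥(standardParabolicGL F (lastBlockLabel 2))) 1 • mk v ∈ K₀ := fun v => by
    rw [← hmk]; exact hclosed _ v
  obtain ⟨Λ, hΛ⟩ := Module.Projective.exists_dual_ne_zero ℂ hv₀0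
  refine ⟨Λ ∘ₗ ((JP (⟨diagGL (Fin 2) (Function.update 1 (Fin.last 1) x), diagGL_mem_standardParabolicGL _ _⟩ : ↥(standardParabolicGL F (lastBlockLabel 2))) - σ' (⟨diagGL (Fin 2) (Function.update 1 (Fin.last 1) x), diagGL_mem_standardParabolicGL _ _⟩ : ↥(standardParabolicGL F (lastBlockLabel 2))) 1 • LinearMap.id) ∘ₗ mk), ?_, fun p v => ?_⟩
  · -- `λ(v₀) = (b − a) Λ(mk v₀) ≠ 0`
    rw [LinearMap.comp_apply, LinearMap.comp_apply, LinearMap.sub_apply, LinearMap.smul_apply, LinearMap.id_apply,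
      hb _ hv₀, ← sub_smul, map_smul, smul_eq_mul]
    exact mul_ne_zero (sub_ne_zero.2 hab) hΛ
  · -- equivariance `λ(p v) = Λ(p · (A − a) mk v) = σ''(p) λ(v)`
    rw [LinearMap.comp_apply, LinearMap.comp_apply, LinearMap.comp_apply, LinearMap.comp_apply, LinearMap.sub_apply,
      LinearMap.sub_apply, LinearMap.smul_apply, LinearMap.smul_apply, LinearMap.id_apply, LinearMap.id_apply, hmk,
      ← jacquetData_comm_diag JP hU p x, ← LinearMap.map_smul (JP p), ← map_sub (JP p), hsmul p _ (hAK v), map_smul, smul_eq_mul]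

end Abstract


/-! ## §4 The swapped eigenfunctional on `Ind_{Q_{1,1}}^{GL₂} σ'` -/

section Concrete

variable (σ' σ'' : Representation ℂ ↥(standardParabolicGL F (lastBlockLabel 2)) ℂ)

/-- **THE SWAPPED EIGENFUNCTIONAL on `Ind_{Q_{1,1}}^{GL₂} σ'`.** Let `σ'` be a smooth character of `Q_{1,1}` and `σ''` a character
trivial on `U`, equal to `σ'` on scalars, with `σ''(d(ϖ)) = q_F σ'(d₀(ϖ))` for every uniformizer `ϖ` (the open-cell exponent of
`Ind σ'`); assume the two exponents of `Ind σ'` differ at SOME uniformizer: `q_F σ'(d₀(ϖ)) ≠ σ'(d(ϖ))`.  Then there is a NON-ZERO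
linear functional `λ` on `Ind_{Q_{1,1}}^{GL₂} σ'` with `λ(p · f) = σ''(p) λ(f)` for all `p ∈ Q_{1,1}` (§3 at the Jacquet module
★ `Representation.toCoinvariants` ∕ ★ `restrictUnipotentGL` and the open-cell part `[I_open]`).
[cite: BernsteinZelevinsky1977, Geometrical Lemma 2.12, Thm. 5.2 and §7.1] [cite: Casselman1995, §6.3 and Lemma 7.1.1] -/
theorem exists_swapFunctional (hσ' : σ'.IsSmooth)
    (hU'' : ∀ u : ↥(standardParabolicGL F (lastBlockLabel 2)), u ∈ (unipotentRadicalP F (lastBlockLabel 2)) → σ'' u = 1)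
    (hz : ∀ t : Fˣ, σ'' (⟨diagGL (Fin 2) (fun _ => t), diagGL_mem_standardParabolicGL _ _⟩ : ↥(standardParabolicGL F (lastBlockLabel 2))) 1 = σ' (⟨diagGL (Fin 2) (fun _ => t), diagGL_mem_standardParabolicGL _ _⟩ : ↥(standardParabolicGL F (lastBlockLabel 2))) 1)
    (hd : ∀ (ϖ : F) (hϖ : IsUniformizingElement ϖ),
      σ'' (⟨diagGL (Fin 2) (Function.update 1 (Fin.last 1) (Units.mk0 ϖ hϖ.ne_zero)), diagGL_mem_standardParabolicGL _ _⟩ : ↥(standardParabolicGL F (lastBlockLabel 2))) 1 = (GaloisRepresentations.IsNonarchimedeanLocalField.residueFieldCard F : ℂ) * σ' (⟨diagGL (Fin 2) (Function.update 1 0 (Units.mk0 ϖ hϖ.ne_zero)), diagGL_mem_standardParabolicGL _ _⟩ : ↥(standardParabolicGL F (lastBlockLabel 2))) 1)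
    (hne : ∃ (ϖ : F) (hϖ : IsUniformizingElement ϖ),
      (GaloisRepresentations.IsNonarchimedeanLocalField.residueFieldCard F : ℂ) * σ' (⟨diagGL (Fin 2) (Function.update 1 0 (Units.mk0 ϖ hϖ.ne_zero)), diagGL_mem_standardParabolicGL _ _⟩ : ↥(standardParabolicGL F (lastBlockLabel 2))) 1 ≠ σ' (⟨diagGL (Fin 2) (Function.update 1 (Fin.last 1) (Units.mk0 ϖ hϖ.ne_zero)), diagGL_mem_standardParabolicGL _ _⟩ : ↥(standardParabolicGL F (lastBlockLabel 2))) 1) :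
    ∃ lam : (Representation.SmoothInd (standardParabolicGL F (lastBlockLabel 2)) σ') →ₗ[ℂ] ℂ, lam ≠ 0 ∧
      ∀ (p : ↥(standardParabolicGL F (lastBlockLabel 2))) (f : (Representation.SmoothInd (standardParabolicGL F (lastBlockLabel 2)) σ')), lam ((Representation.smoothIndRep (standardParabolicGL F (lastBlockLabel 2)) σ') (p : GL (Fin 2) F) f) = σ'' p 1 * lam f := by
  obtain ⟨ϖ, hϖ, hab⟩ := hne
  obtain ⟨f₀, hf₀, hf₀0⟩ := exists_mem_vanishingOn_mk_ne_zero σ' hσ'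
  have hK : ∀ (p : ↥(standardParabolicGL F (lastBlockLabel 2))) (y : (Representation.restrictUnipotentGL F (lastBlockLabel 2) (Representation.smoothIndRep (standardParabolicGL F (lastBlockLabel 2)) σ')).Coinvariants), y ∈ (Submodule.map (Representation.Coinvariants.mk (Representation.restrictUnipotentGL F (lastBlockLabel 2) (Representation.smoothIndRep (standardParabolicGL F (lastBlockLabel 2)) σ'))) (vanishingOn (standardParabolicGL F (lastBlockLabel 2)) σ' (cellLT (K := F) (lastBlockLabel 2) Fin.revPerm))) → (Representation.toCoinvariants ((Representation.smoothIndRep (standardParabolicGL F (lastBlockLabel 2)) σ').comp (standardParabolicGL F (lastBlockLabel 2)).subtype) (unipotentRadicalP F (lastBlockLabel 2))) p y ∈ (Submodule.map (Representation.Coinvariants.mk (Representation.restrictUnipotentGL F (lastBlockLabel 2) (Representation.smoothIndRep (standardParabolicGL F (lastBlockLabel 2)) σ'))) (vanishingOn (standardParabolicGL F (lastBlockLabel 2)) σ' (cellLT (K := F) (lastBlockLabel 2) Fin.revPerm))) :=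
    fun p y hy => toCoinvariants_apply_mem_of_mem σ' p hy
  have hU : ∀ u : ↥(standardParabolicGL F (lastBlockLabel 2)), u ∈ (unipotentRadicalP F (lastBlockLabel 2)) → ∀ y : (Representation.restrictUnipotentGL F (lastBlockLabel 2) (Representation.smoothIndRep (standardParabolicGL F (lastBlockLabel 2)) σ')).Coinvariants, (Representation.toCoinvariants ((Representation.smoothIndRep (standardParabolicGL F (lastBlockLabel 2)) σ').comp (standardParabolicGL F (lastBlockLabel 2)).subtype) (unipotentRadicalP F (lastBlockLabel 2))) u y = y :=
    toCoinvariants_apply_of_mem_unipotentRadicalP σ'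
  have hunif : ∀ (ϖ' : F) (hϖ' : IsUniformizingElement ϖ') (y : (Representation.restrictUnipotentGL F (lastBlockLabel 2) (Representation.smoothIndRep (standardParabolicGL F (lastBlockLabel 2)) σ')).Coinvariants), y ∈ (Submodule.map (Representation.Coinvariants.mk (Representation.restrictUnipotentGL F (lastBlockLabel 2) (Representation.smoothIndRep (standardParabolicGL F (lastBlockLabel 2)) σ'))) (vanishingOn (standardParabolicGL F (lastBlockLabel 2)) σ' (cellLT (K := F) (lastBlockLabel 2) Fin.revPerm))) →
      (Representation.toCoinvariants ((Representation.smoothIndRep (standardParabolicGL F (lastBlockLabel 2)) σ').comp (standardParabolicGL F (lastBlockLabel 2)).subtype) (unipotentRadicalP F (lastBlockLabel 2))) (⟨diagGL (Fin 2) (Function.update 1 (Fin.last 1) (Units.mk0 ϖ' hϖ'.ne_zero)), diagGL_mem_standardParabolicGL _ _⟩ : ↥(standardParabolicGL F (lastBlockLabel 2))) y = σ'' (⟨diagGL (Fin 2) (Function.update 1 (Fin.last 1) (Units.mk0 ϖ' hϖ'.ne_zero)), diagGL_mem_standardParabolicGL _ _⟩ : ↥(standardParabolicGL F (lastBlockLabel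 2))) 1 • y :=
    fun ϖ' hϖ' y hy => by
      rw [hd ϖ' hϖ']
      exact toCoinvariants_diag_uniformizer_apply_of_mem σ' hσ' hϖ' y hy
  have hzJ : ∀ (t : Fˣ) (y : (Representation.restrictUnipotentGL F (lastBlockLabel 2) (Representation.smoothIndRep (standardParabolicGL F (lastBlockLabel 2)) σ')).Coinvariants), (Representation.toCoinvariants ((Representation.smoothIndRep (standardParabolicGL F (lastBlockLabel 2)) σ').comp (standardParabolicGL F (lastBlockLabel 2)).subtype) (unipotentRadicalP F (lastBlockLabel 2))) (⟨diagGL (Fin 2) (fun _ => t), diagGL_mem_standardParabolicGL _ _⟩ : ↥(standardParabolicGL F (lastBlockLabel 2))) y = σ'' (⟨diagGL (Fin 2) (fun _ => t), diagGL_mem_standardParabolicGL _ _⟩ : ↥(standardParabolicGL F (lastBlockLabel 2))) 1 • y := fun t y => by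
    rw [hz t]
    exact toCoinvariants_scalar_apply σ' t y
  obtain ⟨lam, hlam0, hlam⟩ := exists_eigenfunctional_of_jacquetData σ' σ'' (Representation.toCoinvariants ((Representation.smoothIndRep (standardParabolicGL F (lastBlockLabel 2)) σ').comp (standardParabolicGL F (lastBlockLabel 2)).subtype) (unipotentRadicalP F (lastBlockLabel 2))) (Submodule.map (Representation.Coinvariants.mk (Representation.restrictUnipotentGL F (lastBlockLabel 2) (Representation.smoothIndRep (standardParabolicGL F (lastBlockLabel 2)) σ'))) (vanishingOn (standardParabolicGL F (lastBlockLabel 2)) σ' (cellLT (K := F) (lastBlockLabel 2) Fin.revPerm)))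
    ((Representation.smoothIndRep (standardParabolicGL F (lastBlockLabel 2)) σ').comp (standardParabolicGL F (lastBlockLabel 2)).subtype) (Representation.Coinvariants.mk (Representation.restrictUnipotentGL F (lastBlockLabel 2) (Representation.smoothIndRep (standardParabolicGL F (lastBlockLabel 2)) σ'))) (fun p v => rfl) (mk_smoothIndRep_sub_smul_mem σ') hU
    (jacquetData_smul_of_mem σ'' (Representation.toCoinvariants ((Representation.smoothIndRep (standardParabolicGL F (lastBlockLabel 2)) σ').comp (standardParabolicGL F (lastBlockLabel 2)).subtype) (unipotentRadicalP F (lastBlockLabel 2))) (Submodule.map (Representation.Coinvariants.mk (Representation.restrictUnipotentGL F (lastBlockLabel 2) (Representation.smoothIndRep (standardParabolicGL F (lastBlockLabel 2)) σ'))) (vanishingOn (standardParabolicGL F (lastBlockLabel 2)) σ' (cellLT (K := F) (lastBlockLabel 2) Fin.revPerm))) hK hU hU'' hzJ hunif)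
    (fun y hy => toCoinvariants_diag_uniformizer_apply_of_mem σ' hσ' hϖ y hy) hab
    (Submodule.mem_map.2 ⟨f₀, hf₀, rfl⟩) hf₀0
  exact ⟨lam, fun h => hlam0 (by rw [h, LinearMap.zero_apply]), fun p f => hlam p f⟩

end Concrete

/-! ## §5 The Weyl symmetry `i(ν ⊠ χ′) ≅ i(χ′ ⊠ ν)` -/

section Main

variable [LocallyCompactSpace (standardParabolicGL F (lastBlockLabel 2))] (ν χ' : Fˣ →* ℂˣ)

omit [ValuativeRel F] [TopologicalSpace F] [IsNonarchimedeanLocalField F] [LocallyCompactSpace (standardParabolicGL F (lastBlockLabel 2))] in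
/-- `z(t) = d₀(t) d(t)` in `Q_{1,1}`. [cite: BernsteinZelevinsky1977, §2.1] -/
theorem scalar_eq_diag_zero_mul_diag_last (t : Fˣ) : (⟨diagGL (Fin 2) (fun _ => t), diagGL_mem_standardParabolicGL _ _⟩ : ↥(standardParabolicGL F (lastBlockLabel 2))) = (⟨diagGL (Fin 2) (Function.update 1 0 t), diagGL_mem_standardParabolicGL _ _⟩ : ↥(standardParabolicGL F (lastBlockLabel 2))) * (⟨diagGL (Fin 2) (Function.update 1 (Fin.last 1) t), diagGL_mem_standardParabolicGL _ _⟩ : ↥(standardParabolicGL F (lastBlockLabel 2))) :=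
  Subtype.ext (by
    change diagGL (Fin 2) (fun _ => t) = diagGL (Fin 2) (Function.update 1 0 t) * diagGL (Fin 2) (Function.update 1 (Fin.last 1) t)
    rw [← map_mul]
    congr 1
    funext i
    have h1 : (Fin.last 1 : Fin 2) = 1 := rfl
    fin_cases i <;> simp [h1])

/-- **A NON-ZERO INTERTWINING OPERATOR `M(w₀) : i(ν ⊠ χ′) → i(χ′ ⊠ ν)` for `ν ≠ χ′` continuous** (Frobenius reciprocity applied to
the swapped eigenfunctional of §4). [cite: BernsteinZelevinsky1977, Thm. 5.2, §7.1 and Prop. 1.9] [cite: Bump1997, §4.5] -/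
theorem exists_intertwiningMap_swap_ne_zero (hne : ν ≠ χ')
    (hνc : Continuous fun x => ((ν x : ℂˣ) : ℂ)) (hχ'c : Continuous fun x => ((χ' x : ℂˣ) : ℂ)) :
    ∃ T : (Representation.parabolicIndGL F (lastBlockLabel 2) ((Representation.trivial ℂ (Π a : Bool, GL {i : Fin 2 // lastBlockLabel 2 i = a} F) ℂ).twist (maxParabolicLeviChar F 2 ν χ'))).IntertwiningMap (Representation.parabolicIndGL F (lastBlockLabel 2) ((Representation.trivial ℂ (Π a : Bool, GL {i : Fin 2 // lastBlockLabel 2 i = a} F) ℂ).twist (maxParabolicLeviChar F 2 χ' ν))), T ≠ 0 := by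
  classical
  -- the hypotheses of §4 for `σ' = (ν ⊠ χ′) ⊗ δ^{1/2}`, `σ'' = (χ′ ⊠ ν) ⊗ δ^{1/2}`
  have hσ' : (Representation.twist (((Representation.trivial ℂ (Π a : Bool, GL {i : Fin 2 // lastBlockLabel 2 i = a} F) ℂ).twist (maxParabolicLeviChar F 2 ν χ')).comp (leviProjection F (lastBlockLabel 2))) (rootDeltaChar (standardParabolicGL F (lastBlockLabel 2)))).IsSmooth := detCharDatum_isSmooth F 2 ν χ' hνc hχ'c
  have hU'' : ∀ u : ↥(standardParabolicGL F (lastBlockLabel 2)), u ∈ (unipotentRadicalP F (lastBlockLabel 2)) → (Representation.twist (((Representation.trivial ℂ (Π a : Bool, GL {i : Fin 2 // lastBlockLabel 2 i = a} F) ℂ).twist (maxParabolicLeviChar F 2 χ' ν)).comp (leviProjection F (lastBlockLabel 2))) (rootDeltaChar (standardParabolicGL F (lastBlockLabel 2)))) u = 1 :=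
    fun u hu => detCharDatum_eq_one_of_mem_unipotentRadicalP F 2 χ' ν u hu
  have hz : ∀ t : Fˣ, (Representation.twist (((Representation.trivial ℂ (Π a : Bool, GL {i : Fin 2 // lastBlockLabel 2 i = a} F) ℂ).twist (maxParabolicLeviChar F 2 χ' ν)).comp (leviProjection F (lastBlockLabel 2))) (rootDeltaChar (standardParabolicGL F (lastBlockLabel 2)))) (⟨diagGL (Fin 2) (fun _ => t), diagGL_mem_standardParabolicGL _ _⟩ : ↥(standardParabolicGL F (lastBlockLabel 2))) 1 = (Representation.twist (((Representation.trivial ℂ (Π a : Bool, GL {i : Fin 2 // lastBlockLabel 2 i = a} F) ℂ).twist (maxParabolicLeviChar F 2 ν χ')).comp (leviProjection F (lastBlockLabel 2))) (rootDeltaChar (standardParabolicGL F (lastBlockLabel 2)))) (⟨diagGL (Fin 2) (fun _ => t), diagGL_mem_standardParabolicGL _ _⟩ : ↥(standardParabolicGL F (lastBlockLabel 2))) 1 := by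
    intro t
    rw [scalar_eq_diag_zero_mul_diag_last, map_mul (Representation.twist (((Representation.trivial ℂ (Π a : Bool, GL {i : Fin 2 // lastBlockLabel 2 i = a} F) ℂ).twist (maxParabolicLeviChar F 2 χ' ν)).comp (leviProjection F (lastBlockLabel 2))) (rootDeltaChar (standardParabolicGL F (lastBlockLabel 2)))), map_mul (Representation.twist (((Representation.trivial ℂ (Π a : Bool, GL {i : Fin 2 // lastBlockLabel 2 i = a} F) ℂ).twist (maxParabolicLeviChar F 2 ν χ')).comp (leviProjection F (lastBlockLabel 2))) (rootDeltaChar (standardParabolicGL F (lastBlockLabel 2)))),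
      Module.End.mul_apply, Module.End.mul_apply,
      detCharDatum_apply, detCharDatum_apply, detCharDatum_apply, detCharDatum_apply,
      maxParabolicLeviChar_leviProjection_diag_last F (n := 0), maxParabolicLeviChar_leviProjection_diag_zero F (n := 0),
      maxParabolicLeviChar_leviProjection_diag_last F (n := 0), maxParabolicLeviChar_leviProjection_diag_zero F (n := 0)]
    ring
  have hd : ∀ (ϖ : F) (hϖ : IsUniformizingElement ϖ),
      (Representation.twist (((Representation.trivial ℂ (Π a : Bool, GL {i : Fin 2 // lastBlockLabel 2 i = a} F) ℂ).twist (maxParabolicLeviChar F 2 χ' ν)).comp (leviProjection F (lastBlockLabel 2))) (rootDeltaChar (standardParabolicGL F (lastBlockLabel 2)))) (⟨diagGL (Fin 2) (Function.update 1 (Fin.last 1) (Units.mk0 ϖ hϖ.ne_zero)), diagGL_mem_standardParabolicGL _ _⟩ : ↥(standardParabolicGL F (lastBlockLabel 2))) 1 =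
        (GaloisRepresentations.IsNonarchimedeanLocalField.residueFieldCard F : ℂ) * (Representation.twist (((Representation.trivial ℂ (Π a : Bool, GL {i : Fin 2 // lastBlockLabel 2 i = a} F) ℂ).twist (maxParabolicLeviChar F 2 ν χ')).comp (leviProjection F (lastBlockLabel 2))) (rootDeltaChar (standardParabolicGL F (lastBlockLabel 2)))) (⟨diagGL (Fin 2) (Function.update 1 0 (Units.mk0 ϖ hϖ.ne_zero)), diagGL_mem_standardParabolicGL _ _⟩ : ↥(standardParabolicGL F (lastBlockLabel 2))) 1 := by
    intro ϖ hϖ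
    rw [detCharDatum_diag_last_uniformizer F (n := 0) χ' ν hϖ,
      residueFieldCard_mul_detCharDatum_diag_zero_uniformizer F (n := 0) ν χ' hϖ, zero_add, pow_one]
  obtain ⟨lam, hlam0, hlam⟩ := exists_swapFunctional (Representation.twist (((Representation.trivial ℂ (Π a : Bool, GL {i : Fin 2 // lastBlockLabel 2 i = a} F) ℂ).twist (maxParabolicLeviChar F 2 ν χ')).comp (leviProjection F (lastBlockLabel 2))) (rootDeltaChar (standardParabolicGL F (lastBlockLabel 2)))) (Representation.twist (((Representation.trivial ℂ (Π a : Bool, GL {i : Fin 2 // lastBlockLabel 2 i = a} F) ℂ).twist (maxParabolicLeviChar F 2 χ' ν)).comp (leviProjection F (lastBlockLabel 2))) (rootDeltaChar (standardParabolicGL F (lastBlockLabel 2)))) hσ' hU'' hz hd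
    (exists_isUniformizingElement_detCharDatum_ne F ν χ' hne)
  -- Frobenius reciprocity
  let φ : Representation.IntertwiningMap ((Representation.parabolicIndGL F (lastBlockLabel 2) ((Representation.trivial ℂ (Π a : Bool, GL {i : Fin 2 // lastBlockLabel 2 i = a} F) ℂ).twist (maxParabolicLeviChar F 2 ν χ'))).comp (standardParabolicGL F (lastBlockLabel 2)).subtype) (Representation.twist (((Representation.trivial ℂ (Π a : Bool, GL {i : Fin 2 // lastBlockLabel 2 i = a} F) ℂ).twist (maxParabolicLeviChar F 2 χ' ν)).comp (leviProjection F (lastBlockLabel 2))) (rootDeltaChar (standardParabolicGL F (lastBlockLabel 2)))) :=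
    { toLinearMap := lam
      isIntertwining' := fun p => LinearMap.ext fun f => by
        rw [LinearMap.comp_apply, LinearMap.comp_apply, apply_eq_mul_apply_one_two _ p (lam f)]
        exact hlam p f }
  have hI : (Representation.parabolicIndGL F (lastBlockLabel 2) ((Representation.trivial ℂ (Π a : Bool, GL {i : Fin 2 // lastBlockLabel 2 i = a} F) ℂ).twist (maxParabolicLeviChar F 2 ν χ'))).IsSmooth := Representation.isSmooth_smoothInd _ _
  obtain ⟨f, hf⟩ := DFunLike.ne_iff.1 hlam0
  refine ⟨Representation.frobeniusInv hI φ, fun h0 => hf ?_⟩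
  have h1 := Representation.toFun_frobeniusInv_apply hI φ f 1
  rw [h0, map_one] at h1
  rw [LinearMap.zero_apply]
  exact (show (0 : ℂ) = lam f from h1).symm

/-- **THE WEYL SYMMETRY OF THE UNITARY PRINCIPAL SERIES OF `GL₂(F)`** ([BernsteinZelevinsky1977, Thm. 2.9]; [Bump1997, Thm. 4.5.3]):
for UNITARY CONTINUOUS characters `ν, χ′ : Fˣ → ℂˣ` of a non-archimedean local field `F`, the normalised principal series
`i(ν ⊠ χ′) = Ind_{Q_{1,1}}^{GL₂}((ν ⊠ χ′) ⊗ δ^{1/2})` and `i(χ′ ⊠ ν)` (the tree's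
`Representation.parabolicIndGL F (lastBlockLabel 2) (𝟙.twist (maxParabolicLeviChar F 2 · ·))`) are ISOMORPHIC
(`Liu2021.AreIsomorphicRep`: an equivariant linear equivalence).  Proof: for `ν = χ′` trivially; for `ν ≠ χ′` the non-zero
intertwining operator `M(w₀)` of `exists_intertwiningMap_swap_ne_zero` between two IRREDUCIBLE representations
(★ `parabolicIndGL_detChar_unitary_isIrreducible_holds`, [Zelevinsky1980, Thm. 4.2]) is bijective (Schur).
[cite: BernsteinZelevinsky1977, Thm. 2.9] [cite: Bump1997, Thm. 4.5.3] [cite: Zelevinsky1980, Thm. 4.2] -/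
theorem areIsomorphicRep_parabolicIndGL_two_swap
    (hνu : ∀ x, ‖((ν x : ℂˣ) : ℂ)‖ = 1) (hνc : Continuous fun x => ((ν x : ℂˣ) : ℂ))
    (hχ'u : ∀ x, ‖((χ' x : ℂˣ) : ℂ)‖ = 1) (hχ'c : Continuous fun x => ((χ' x : ℂˣ) : ℂ)) :
    Liu2021.AreIsomorphicRep (Representation.parabolicIndGL F (lastBlockLabel 2) ((Representation.trivial ℂ (Π a : Bool, GL {i : Fin 2 // lastBlockLabel 2 i = a} F) ℂ).twist (maxParabolicLeviChar F 2 ν χ'))) (Representation.parabolicIndGL F (lastBlockLabel 2) ((Representation.trivial ℂ (Π a : Bool, GL {i : Fin 2 // lastBlockLabel 2 i = a} F) ℂ).twist (maxParabolicLeviChar F 2 χ' ν))) := by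
  classical
  by_cases hne : ν = χ'
  · subst hne
    exact Liu2021.AreIsomorphicRep.refl _
  obtain ⟨T, hT⟩ := exists_intertwiningMap_swap_ne_zero ν χ' hne hνc hχ'c
  haveI h₁ : (Representation.parabolicIndGL F (lastBlockLabel 2) ((Representation.trivial ℂ (Π a : Bool, GL {i : Fin 2 // lastBlockLabel 2 i = a} F) ℂ).twist (maxParabolicLeviChar F 2 ν χ'))).IsIrreducible :=
    parabolicIndGL_detChar_unitary_isIrreducible_holds F 2 ν χ' hνu hνc hχ'u hχ'c
  haveI h₂ : (Representation.parabolicIndGL F (lastBlockLabel 2) ((Representation.trivial ℂ (Π a : Bool, GL {i : Fin 2 // lastBlockLabel 2 i = a} F) ℂ).twist (maxParabolicLeviChar F 2 χ' ν))).IsIrreducible :=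
    parabolicIndGL_detChar_unitary_isIrreducible_holds F 2 χ' ν hχ'u hχ'c hνu hνc
  rcases Representation.IsIrreducible.bijective_or_eq_zero T with hbij | h0
  · exact Liu2021.areIsomorphicRep_of_equiv (T.ofBijective hbij)
  · exact absurd h0 hT

end Main

end Literature.NumberTheory.Automorphic.Zelevinsky1980

end
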